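import Summits.QuantumFields.YangMills.Theorems.OnsetSkewLawRPOnsetFloorPosTimeSynthTools
import HarnessLib

/-!
# The Whitney-type partition of unity of the open half-space `{z₀ > 0} ⊆ ℝ⁴` (tool for the stub
# `stub_positiveTimeSynthesisCollar` of LINES «FloorInheritance» v5 / «MarkovFloorInheritance» v3, ym-idea-11, cruxes 23138 / 22956)

Built from `…PosTimeSynthProfiles` / `…PosTimeSynthTools`: the PIECES

  `piece (j, n) (z) = layer j (z 0) · ∏_i g (δ_j⁻¹ z_i − n_i)`,   `(j, n) ∈ ℕ × ℤ⁴`,  `δ_j = 1 / (64 · 2^j)`,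

are smooth, nonnegative, compactly supported with temperate growth, satisfy `‖D^m piece (j,n)‖ ≤ A m · δ_j^(−m)` uniformly
(`exists_bound_iteratedFDeriv_piece`), live at heights `32 δ_j ≤ z₀` (`≤ 96 δ_j` for `j ≥ 1`) and within `δ_j` of their centre
`c_(j,n) = δ_j (n + 1)` in every coordinate (`mem_tsupport_piece`, `geometry_of_mem_tsupport_piece`), have their centre at
height `> 31 δ_j` when not identically zero (`centre_time_gt_of_piece_ne_zero`: the COLLAR geometry), SUM TO ONE on
`{z₀ > 0}` (`tsum_piece`, `summable_piece`, `piece_eq_zero_of_nonpos`), and carry summable weights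
`δ_j⁵ (1+‖c_(j,n)‖)^(−14)` with total `≤ 81/32` (`summable_weight`).  Whitney parameter `64`.

HONEST FRAMING: calculus infrastructure; no stub / crux / rung / summit is proved here; the Yang–Mills mass gap is NOT proved.
Cell `ym-idea-1`, width seat `ym-line-sfw-p2-w4` g21 (free hands). [folklore]
-/

set_option autoImplicit false

noncomputable section

open scoped BigOperators ContDiff
open Set

namespace Summit.QuantumFields.YangMills.Theorems.RPOnsetFloorPosTimeSynth

/-! ## §7 The lattice cube profile on `ℝ⁴` -/

/-- The cube profile `F (w) = ∏_i g (w_i)` on `ℝ⁴`: smooth, compactly supported in `[0,2]⁴`, its `ℤ⁴`-translates form a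
partition of unity. [folklore] -/
def cube (w : EuclideanSpace ℝ (Fin 4)) : ℝ := ∏ i, gProfile (w i)

/-- `F` is smooth. [folklore] -/
theorem cube_contDiff : ContDiff ℝ ∞ cube :=
  contDiff_prod fun _ _ => gProfile_contDiff.comp (contDiff_piLp_apply (p := 2))

/-- `0 ≤ F`. [folklore] -/
theorem cube_nonneg (w : EuclideanSpace ℝ (Fin 4)) : 0 ≤ cube w :=
  Finset.prod_nonneg fun _ _ => gProfile_nonneg _

/-- If `F w ≠ 0` then every coordinate of `w` lies in `(0,2)`. [folklore] -/
theorem coord_mem_of_cube_ne_zero {w : EuclideanSpace ℝ (Fin 4)} (hw : cube w ≠ 0) (i : Fin 4) :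
    0 < w i ∧ w i < 2 := by
  apply pos_and_lt_two_of_gProfile_ne_zero
  intro h
  exact hw (Finset.prod_eq_zero (Finset.mem_univ i) h)

/-- `F` has compact support (inside the box `[0,2]⁴ ⊆ closedBall 0 4`). [folklore] -/
theorem hasCompactSupport_cube : HasCompactSupport cube := by
  apply HasCompactSupport.of_support_subset_isCompact (K := {w : EuclideanSpace ℝ (Fin 4) | ∀ i, w i ∈ Icc (0:ℝ) 2})
  · apply Metric.isCompact_of_isClosed_isBounded
    · have : {w : EuclideanSpace ℝ (Fin 4) | ∀ i, w i ∈ Icc (0:ℝ) 2} =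
          ⋂ i : Fin 4, (fun w : EuclideanSpace ℝ (Fin 4) => w i) ⁻¹' Icc 0 2 := by
        ext w; simp
      rw [this]
      exact isClosed_iInter fun i => isClosed_Icc.preimage (contDiff_piLp_apply (p := 2) (𝕜 := ℝ) (n := 0)).continuous
    · rw [Metric.isBounded_iff_subset_closedBall (0 : EuclideanSpace ℝ (Fin 4))]
      refine ⟨2 * 2, fun w hw => ?_⟩
      rw [Metric.mem_closedBall, dist_zero_right]
      exact norm_le_two_mul_of_abs_le w zero_le_two fun i => by
        have := hw i; rw [abs_le]; exact ⟨by linarith [this.1], this.2⟩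
  · intro w hw i
    have h := coord_mem_of_cube_ne_zero (Function.mem_support.1 hw) i
    exact ⟨h.1.le, h.2.le⟩

/-! ## §8 The pieces of the partition of unity of the open half-space -/

/-- Lattice spacing of layer `j`: `δ_j = 1 / (64 · 2^j)` (Whitney parameter `64`). [folklore] -/
def spacing (j : ℕ) : ℝ := ((64 : ℝ) * 2 ^ j)⁻¹

/-- `0 < δ_j`. [folklore] -/
theorem spacing_pos (j : ℕ) : 0 < spacing j := by unfold spacing; positivity

/-- `δ_j⁻¹ = 64 · 2^j`. [folklore] -/
theorem spacing_inv (j : ℕ) : (spacing j)⁻¹ = 64 * 2 ^ j := by unfold spacing; rw [inv_inv]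

/-- `δ_j ≤ 1/64`. [folklore] -/
theorem spacing_le (j : ℕ) : spacing j ≤ 1 / 64 := by
  unfold spacing
  rw [one_div]
  exact inv_anti₀ (by norm_num) (by
    have : (1 : ℝ) ≤ 2 ^ j := one_le_pow₀ (by norm_num)
    linarith)

/-- `2^(j+2) ≤ δ_j⁻¹`. [folklore] -/
theorem two_pow_le_spacing_inv (j : ℕ) : (2 : ℝ) ^ (j + 2) ≤ (spacing j)⁻¹ := by
  rw [spacing_inv, pow_add]; nlinarith [pow_pos (show (0:ℝ) < 2 by norm_num) j]

/-- `2^(-(j+1)) = 32 δ_j`, in the form `2 / 2^(j+2) = 32 δ_j`. [folklore] -/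
theorem two_div_two_pow (j : ℕ) : (2 : ℝ) / 2 ^ (j + 2) = 32 * spacing j := by
  unfold spacing; rw [pow_add]; field_simp; norm_num

/-- The index set of the pieces: layer `j : ℕ` and lattice point `n : ℤ⁴`. -/
abbrev PieceIdx := ℕ × (Fin 4 → ℤ)

/-- Centre of the piece `(j,n)`: `c_i = δ_j (n_i + 1)`. [folklore] -/
def centre (p : PieceIdx) : EuclideanSpace ℝ (Fin 4) := WithLp.toLp 2 fun i => spacing p.1 * ((p.2 i : ℝ) + 1)

/-- `centre p i = δ_j (n_i + 1)`. [folklore] -/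
@[simp] theorem centre_apply (p : PieceIdx) (i : Fin 4) : centre p i = spacing p.1 * ((p.2 i : ℝ) + 1) := rfl

/-- The lattice factor of the piece `(j,n)`: `z ↦ F (δ_j⁻¹ z - n)`. [folklore] -/
def latticeFn (p : PieceIdx) (z : EuclideanSpace ℝ (Fin 4)) : ℝ :=
  cube ((spacing p.1)⁻¹ • z - WithLp.toLp 2 fun i => (p.2 i : ℝ))

/-- Coordinate form of the lattice factor. [folklore] -/
theorem latticeFn_eq (p : PieceIdx) (z : EuclideanSpace ℝ (Fin 4)) :
    latticeFn p z = ∏ i, gProfile ((spacing p.1)⁻¹ * z i - p.2 i) := by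
  simp [latticeFn, cube]

/-- THE PIECES `χ_(j,n) (z) = layer j (z 0) · F (δ_j⁻¹ z - n)` of the partition of unity of `{z₀ > 0}`. [folklore] -/
def piece (p : PieceIdx) (z : EuclideanSpace ℝ (Fin 4)) : ℝ := layer p.1 (z 0) * latticeFn p z

/-- `0 ≤ χ_p`. [folklore] -/
theorem piece_nonneg (p : PieceIdx) (z : EuclideanSpace ℝ (Fin 4)) : 0 ≤ piece p z :=
  mul_nonneg (layer_nonneg _ _) (cube_nonneg _)

/-- `χ_p` is smooth. [folklore] -/
theorem piece_contDiff (p : PieceIdx) : ContDiff ℝ ∞ (piece p) := by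
  refine ContDiff.mul (((layer_contDiff p.1)).comp (contDiff_piLp_apply (p := 2))) ?_
  exact cube_contDiff.comp ((contDiff_id.const_smul _).sub contDiff_const)

/-- `χ_p` has compact support. [folklore] -/
theorem hasCompactSupport_piece (p : PieceIdx) : HasCompactSupport (piece p) := by
  have h : HasCompactSupport (latticeFn p) := by
    unfold latticeFn
    refine hasCompactSupport_cube.comp_homeomorph
      ((Homeomorph.smulOfNeZero (spacing p.1)⁻¹ (inv_ne_zero (spacing_pos p.1).ne')).trans
        (Homeomorph.subRight (WithLp.toLp 2 fun i => (p.2 i : ℝ))))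
  exact h.mul_left

/-- `χ_p` has temperate growth (smooth with compact support). [folklore] -/
theorem piece_hasTemperateGrowth (p : PieceIdx) : (piece p).HasTemperateGrowth :=
  (hasCompactSupport_piece p).hasTemperateGrowth (piece_contDiff p)

/-! ## §9 Support geometry of the pieces -/

/-- If `χ_p z ≠ 0` then `32 δ_j < z 0` (the layer is switched on) and, for `j ≥ 1`, `z 0 < 96 δ_j`. [folklore] -/
theorem time_bounds_of_piece_ne_zero {p : PieceIdx} {z : EuclideanSpace ℝ (Fin 4)} (hz : piece p z ≠ 0) :
    32 * spacing p.1 < z 0 ∧ (1 ≤ p.1 → z 0 < 96 * spacing p.1) := by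
  have hl : layer p.1 (z 0) ≠ 0 := fun h => hz (by simp [piece, h])
  have hpow : (0 : ℝ) < 2 ^ (p.1 + 2) := by positivity
  constructor
  · have h2 := two_lt_of_layer_ne_zero hl
    rw [← two_div_two_pow, div_lt_iff₀ hpow]; linarith
  · intro hj
    have h6 := lt_six_of_layer_ne_zero hl hj
    have : (96 : ℝ) * spacing p.1 = 6 / 2 ^ (p.1 + 2) := by
      rw [show (96 : ℝ) * spacing p.1 = 3 * (32 * spacing p.1) by ring, ← two_div_two_pow]; ring
    rw [this, lt_div_iff₀ hpow]; linarith

/-- If `χ_p z ≠ 0` then every coordinate of `z` is within `δ_j` of the centre (open version). [folklore] -/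
theorem abs_sub_centre_lt_of_piece_ne_zero {p : PieceIdx} {z : EuclideanSpace ℝ (Fin 4)} (hz : piece p z ≠ 0)
    (i : Fin 4) : |z i - centre p i| < spacing p.1 := by
  have hl : latticeFn p z ≠ 0 := fun h => hz (by simp [piece, h])
  have hc := coord_mem_of_cube_ne_zero (w := (spacing p.1)⁻¹ • z - WithLp.toLp 2 fun i => (p.2 i : ℝ)) hl i
  simp only [PiLp.sub_apply, PiLp.smul_apply, smul_eq_mul] at hc
  have hδ := spacing_pos p.1
  rw [centre_apply, abs_lt]
  constructor
  · have := mul_lt_mul_of_pos_left hc.1 hδ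
    rw [mul_zero, mul_sub, ← mul_assoc, mul_inv_cancel₀ hδ.ne', one_mul] at this
    linarith
  · have := mul_lt_mul_of_pos_left hc.2 hδ
    rw [mul_sub, ← mul_assoc, mul_inv_cancel₀ hδ.ne', one_mul] at this
    linarith

/-- COLLAR GEOMETRY: a piece that is not identically zero has its centre at height `> 31 δ_j`. [folklore] -/
theorem centre_time_gt_of_piece_ne_zero {p : PieceIdx} {z : EuclideanSpace ℝ (Fin 4)} (hz : piece p z ≠ 0) :
    31 * spacing p.1 < centre p 0 := by
  have h1 := (time_bounds_of_piece_ne_zero hz).1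
  have h2 := (abs_lt.1 (abs_sub_centre_lt_of_piece_ne_zero hz 0)).2
  linarith

/-- Closed version of the support geometry: on `tsupport χ_p` one has `32 δ_j ≤ z 0`, `z 0 ≤ 96 δ_j` when `j ≥ 1`, and
`|z_i - c_i| ≤ δ_j` for every coordinate. [folklore] -/
theorem mem_tsupport_piece {p : PieceIdx} {z : EuclideanSpace ℝ (Fin 4)} (hz : z ∈ tsupport (piece p)) :
    32 * spacing p.1 ≤ z 0 ∧ (1 ≤ p.1 → z 0 ≤ 96 * spacing p.1) ∧ ∀ i, |z i - centre p i| ≤ spacing p.1 := by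
  have hcont : ∀ i : Fin 4, Continuous fun w : EuclideanSpace ℝ (Fin 4) => w i := fun i =>
    (contDiff_piLp_apply (p := 2) (𝕜 := ℝ) (n := 0)).continuous
  -- the closed set containing the support
  have hc1 : IsClosed {w : EuclideanSpace ℝ (Fin 4) | 32 * spacing p.1 ≤ w 0} :=
    isClosed_le continuous_const (hcont 0)
  have hc2 : IsClosed {w : EuclideanSpace ℝ (Fin 4) | 1 ≤ p.1 → w 0 ≤ 96 * spacing p.1} := by
    by_cases hj : 1 ≤ p.1
    · simp only [hj, forall_const]
      exact isClosed_le (hcont 0) continuous_const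
    · simp [hj]
  have hc3 : IsClosed {w : EuclideanSpace ℝ (Fin 4) | ∀ i, |w i - centre p i| ≤ spacing p.1} := by
    have : {w : EuclideanSpace ℝ (Fin 4) | ∀ i, |w i - centre p i| ≤ spacing p.1} =
        ⋂ i, {w | |w i - centre p i| ≤ spacing p.1} := by ext w; simp
    rw [this]
    exact isClosed_iInter fun i => isClosed_le (((hcont i).sub continuous_const).abs) continuous_const
  have hclosed := hc1.inter (hc2.inter hc3)
  have hsub : Function.support (piece p) ⊆ {w : EuclideanSpace ℝ (Fin 4) | 32 * spacing p.1 ≤ w 0} ∩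
      ({w | 1 ≤ p.1 → w 0 ≤ 96 * spacing p.1} ∩ {w | ∀ i, |w i - centre p i| ≤ spacing p.1}) := by
    intro w hw
    have hw' : piece p w ≠ 0 := Function.mem_support.1 hw
    obtain ⟨h1, h2⟩ := time_bounds_of_piece_ne_zero hw'
    exact ⟨h1.le, fun hj => (h2 hj).le, fun i => (abs_sub_centre_lt_of_piece_ne_zero hw' i).le⟩
  obtain ⟨h1, h2, h3⟩ := closure_minimal hsub hclosed hz
  exact ⟨h1, h2, h3⟩

/-- On `tsupport χ_p`: `0 < z 0`, `min (z 0) 1 ≤ 96 δ_j` and `‖z - c_p‖ ≤ 2 δ_j ≤ 1`. [folklore] -/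
theorem geometry_of_mem_tsupport_piece {p : PieceIdx} {z : EuclideanSpace ℝ (Fin 4)} (hz : z ∈ tsupport (piece p)) :
    0 < z 0 ∧ min (z 0) 1 ≤ 96 * spacing p.1 ∧ ‖z - centre p‖ ≤ 2 * spacing p.1 ∧ ‖z - centre p‖ ≤ 1 := by
  obtain ⟨h1, h2, h3⟩ := mem_tsupport_piece hz
  have hδ := spacing_pos p.1
  have hδ' := spacing_le p.1
  have hnorm : ‖z - centre p‖ ≤ 2 * spacing p.1 :=
    norm_le_two_mul_of_abs_le (z - centre p) hδ.le fun i => by simpa only [PiLp.sub_apply] using h3 i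
  refine ⟨by linarith, ?_, hnorm, by linarith⟩
  rcases Nat.eq_zero_or_pos p.1 with hj | hj
  · -- top layer: `min ≤ 1 = 64 δ_0 ≤ 96 δ_0`
    have : spacing p.1 = 1 / 64 := by rw [hj]; unfold spacing; norm_num
    rw [this]; exact (min_le_right _ _).trans (by norm_num)
  · exact (min_le_left _ _).trans (h2 hj)

/-! ## §10 Derivative bounds for the pieces -/

/-- Uniform derivative bounds: `‖D^m χ_(j,n) (z)‖ ≤ A m · (δ_j⁻¹)^m` with `A m ≥ 0` independent of the piece. [folklore] -/
theorem exists_bound_iteratedFDeriv_piece : ∃ A : ℕ → ℝ, (∀ m, 0 ≤ A m) ∧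
    ∀ (p : PieceIdx) (m : ℕ) (z : EuclideanSpace ℝ (Fin 4)),
      ‖iteratedFDeriv ℝ m (piece p) z‖ ≤ A m * ((spacing p.1)⁻¹) ^ m := by
  obtain ⟨Lb, hLb0, hLb⟩ := exists_bound_iteratedFDeriv_layer
  choose Cb hCb0 hCb using exists_bound_iteratedFDeriv_of_hasCompactSupport cube_contDiff hasCompactSupport_cube
  refine ⟨fun m => ∑ i ∈ Finset.range (m + 1), (m.choose i : ℝ) * Lb i * Cb (m - i), fun m =>
    Finset.sum_nonneg fun i _ => by have := hLb0 i; have := hCb0 (m - i); positivity, fun p m z => ?_⟩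
  have hδ := spacing_pos p.1
  -- the lattice factor is the pull-back of `F` along `δ⁻¹ • id`
  have hlat : ∀ (i : ℕ) (w : EuclideanSpace ℝ (Fin 4)),
      ‖iteratedFDeriv ℝ i (latticeFn p) w‖ ≤ Cb i * ((spacing p.1)⁻¹) ^ i := by
    intro i w
    have hfun : latticeFn p = fun z => cube ((((spacing p.1)⁻¹ : ℝ) •
        ContinuousLinearMap.id ℝ (EuclideanSpace ℝ (Fin 4))) z - WithLp.toLp 2 fun i => (p.2 i : ℝ)) := by
      funext z; simp [latticeFn]
    rw [hfun]
    refine (norm_iteratedFDeriv_comp_affine_le cube_contDiff _ _ (hCb i) w).trans ?_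
    refine mul_le_mul_of_nonneg_left (pow_le_pow_left₀ (norm_nonneg _) ?_ i) (hCb0 i)
    rw [norm_smul, Real.norm_of_nonneg (inv_nonneg.2 hδ.le)]
    calc (spacing p.1)⁻¹ * ‖ContinuousLinearMap.id ℝ (EuclideanSpace ℝ (Fin 4))‖ ≤ (spacing p.1)⁻¹ * 1 :=
          mul_le_mul_of_nonneg_left ContinuousLinearMap.norm_id_le (inv_nonneg.2 hδ.le)
      _ = (spacing p.1)⁻¹ := mul_one _
  have hf : ContDiff ℝ m (fun z : EuclideanSpace ℝ (Fin 4) => layer p.1 (z 0)) :=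
    ((layer_contDiff p.1).of_le (mod_cast le_top)).comp (contDiff_piLp_apply (p := 2))
  have hg : ContDiff ℝ m (latticeFn p) :=
    (cube_contDiff.of_le (mod_cast le_top)).comp ((contDiff_id.const_smul _).sub contDiff_const)
  have hpiece : piece p = fun z => layer p.1 (z 0) * latticeFn p z := rfl
  rw [hpiece]
  refine (norm_iteratedFDeriv_mul_le hf hg z le_rfl).trans ?_
  rw [Finset.sum_mul]
  apply Finset.sum_le_sum
  intro i hi
  have him : i ≤ m := Nat.lt_succ_iff.1 (Finset.mem_range.1 hi)
  have h1 := hLb p.1 i z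
  have h2 := hlat (m - i) z
  have hinv1 : (1 : ℝ) ≤ (spacing p.1)⁻¹ := by
    rw [one_le_inv₀ hδ]; linarith [spacing_le p.1]
  have h1' : ‖iteratedFDeriv ℝ i (fun z : EuclideanSpace ℝ (Fin 4) => layer p.1 (z 0)) z‖ ≤
      Lb i * ((spacing p.1)⁻¹) ^ i :=
    h1.trans (mul_le_mul_of_nonneg_left (pow_le_pow_left₀ (by positivity) (two_pow_le_spacing_inv p.1) i) (hLb0 i))
  calc (m.choose i : ℝ) * ‖iteratedFDeriv ℝ i (fun z : EuclideanSpace ℝ (Fin 4) => layer p.1 (z 0)) z‖ *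
          ‖iteratedFDeriv ℝ (m - i) (latticeFn p) z‖
      ≤ (m.choose i : ℝ) * (Lb i * ((spacing p.1)⁻¹) ^ i) * (Cb (m - i) * ((spacing p.1)⁻¹) ^ (m - i)) := by
        exact mul_le_mul (mul_le_mul_of_nonneg_left h1' (Nat.cast_nonneg _)) h2 (norm_nonneg _)
          (mul_nonneg (Nat.cast_nonneg _) (mul_nonneg (hLb0 i) (pow_nonneg (inv_nonneg.2 hδ.le) i)))
    _ = (m.choose i : ℝ) * Lb i * Cb (m - i) * ((spacing p.1)⁻¹) ^ m := by
        rw [show ((spacing p.1)⁻¹) ^ m = ((spacing p.1)⁻¹) ^ i * ((spacing p.1)⁻¹) ^ (m - i) by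
          rw [← pow_add, Nat.add_sub_cancel' him]]
        ring

/-! ## §11 Partition of unity -/

/-- The lattice window of layer `j` at `z`: `n_i ∈ {⌊δ_j⁻¹ z_i⌋ - 1, ⌊δ_j⁻¹ z_i⌋}`. [folklore] -/
def window (j : ℕ) (z : EuclideanSpace ℝ (Fin 4)) : Finset (Fin 4 → ℤ) :=
  Fintype.piFinset fun i => Finset.Icc (⌊(spacing j)⁻¹ * z i⌋ - 1) ⌊(spacing j)⁻¹ * z i⌋

/-- Outside the window the lattice factor vanishes. [folklore] -/
theorem latticeFn_eq_zero_of_not_mem_window {j : ℕ} {z : EuclideanSpace ℝ (Fin 4)} {n : Fin 4 → ℤ}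
    (hn : n ∉ window j z) : latticeFn (j, n) z = 0 := by
  rw [window, Fintype.mem_piFinset] at hn
  push Not at hn
  obtain ⟨i, hi⟩ := hn
  rw [latticeFn_eq]
  exact Finset.prod_eq_zero (Finset.mem_univ i) (gProfile_translate_eq_zero hi)

/-- Over the window the lattice factors sum to `1`. [folklore] -/
theorem sum_latticeFn_window (j : ℕ) (z : EuclideanSpace ℝ (Fin 4)) :
    ∑ n ∈ window j z, latticeFn (j, n) z = 1 := by
  simp only [latticeFn_eq, window]
  rw [← Finset.prod_univ_sum (fun i => Finset.Icc (⌊(spacing j)⁻¹ * z i⌋ - 1) ⌊(spacing j)⁻¹ * z i⌋)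
    (fun i (m : ℤ) => gProfile ((spacing j)⁻¹ * z i - m))]
  exact Finset.prod_eq_one fun i _ => sum_gProfile_window _

/-- The lattice factors of layer `j` form a partition of unity of `ℝ⁴`. [folklore] -/
theorem hasSum_latticeFn (j : ℕ) (z : EuclideanSpace ℝ (Fin 4)) : HasSum (fun n => latticeFn (j, n) z) 1 := by
  rw [← sum_latticeFn_window j z]
  exact hasSum_sum_of_ne_finset_zero fun n hn => latticeFn_eq_zero_of_not_mem_window hn

/-- The layers form a partition of unity of `(0, ∞)`. [folklore] -/
theorem hasSum_layer {t : ℝ} (ht : 0 < t) : HasSum (fun j => layer j t) 1 := by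
  obtain ⟨J, hJ⟩ := exists_layerCum_eq_one ht
  have hzero : ∀ j ∉ Finset.range (J + 1), layer j t = 0 := by
    intro j hj
    rw [Finset.mem_range, not_lt] at hj
    obtain ⟨k, rfl⟩ : ∃ k, j = k + 1 := ⟨j - 1, by omega⟩
    show layerCum (k + 1) t - layerCum k t = 0
    rw [hJ (k + 1) (by omega), hJ k (by omega), sub_self]
  have h : HasSum (fun j => layer j t) (∑ j ∈ Finset.range (J + 1), layer j t) :=
    hasSum_sum_of_ne_finset_zero hzero
  rwa [sum_layer_range, hJ J le_rfl] at h

/-- Below the mirror every piece vanishes. [folklore] -/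
theorem piece_eq_zero_of_nonpos (p : PieceIdx) {z : EuclideanSpace ℝ (Fin 4)} (hz : z 0 ≤ 0) : piece p z = 0 := by
  simp [piece, layer_eq_zero_of_nonpos p.1 hz]

/-- The pieces are summable at every point. [folklore] -/
theorem summable_piece (z : EuclideanSpace ℝ (Fin 4)) : Summable fun p : PieceIdx => piece p z := by
  refine (summable_prod_of_nonneg fun p => piece_nonneg p z).2 ⟨fun j => ?_, ?_⟩
  · exact ((hasSum_latticeFn j z).mul_left (layer j (z 0))).summable
  · have h : (fun j => ∑' n, piece (j, n) z) = fun j => layer j (z 0) := by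
      funext j
      exact ((hasSum_latticeFn j z).mul_left (layer j (z 0))).tsum_eq.trans (mul_one _)
    rw [h]
    by_cases hz : 0 < z 0
    · exact (hasSum_layer hz).summable
    · have h0 : ∀ j, layer j (z 0) = 0 := fun j => layer_eq_zero_of_nonpos j (not_lt.1 hz)
      simp [h0]

/-- **PARTITION OF UNITY of the open half-space**: `∑_p χ_p (z) = 1` for `z 0 > 0`. [folklore] -/
theorem tsum_piece {z : EuclideanSpace ℝ (Fin 4)} (hz : 0 < z 0) : ∑' p : PieceIdx, piece p z = 1 := by
  rw [(summable_piece z).tsum_prod' fun j => ((hasSum_latticeFn j z).mul_left (layer j (z 0))).summable]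
  have h : (fun j => ∑' n, piece (j, n) z) = fun j => layer j (z 0) := by
    funext j
    exact ((hasSum_latticeFn j z).mul_left (layer j (z 0))).tsum_eq.trans (mul_one _)
  simp only [h]
  exact (hasSum_layer hz).tsum_eq

/-! ## §12 The summable weights of the pieces -/

/-- The weight of the piece `(j,n)` in the mass bookkeeping: `w_p = δ_j⁵ (1 + ‖c_p‖)^(−14)`, dominated by the product weight
`δ_j⁵ ∏_i (1 + δ_j |n_i + 1|)^(−3)` of `sum_dyadic_weight_le`. [folklore] -/
theorem weight_le_prod (p : PieceIdx) :
    spacing p.1 ^ 5 * ((1 + ‖centre p‖) ^ 14)⁻¹ ≤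
      ((64 : ℝ) * 2 ^ p.1)⁻¹ ^ 5 * ∏ i, ((1 + ((64 : ℝ) * 2 ^ p.1)⁻¹ * |((p.2 i : ℤ) : ℝ) + 1|) ^ 3)⁻¹ := by
  have hδ := spacing_pos p.1
  have hsp : spacing p.1 = ((64 : ℝ) * 2 ^ p.1)⁻¹ := rfl
  rw [← hsp]
  refine mul_le_mul_of_nonneg_left ?_ (pow_nonneg hδ.le 5)
  have hprod : ∏ i, ((1 + spacing p.1 * |((p.2 i : ℤ) : ℝ) + 1|) ^ 3)⁻¹ = (∏ i, (1 + |centre p i|) ^ 3)⁻¹ := by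
    rw [← Finset.prod_inv_distrib]
    refine Finset.prod_congr rfl fun i _ => ?_
    rw [centre_apply, abs_mul, abs_of_pos hδ]
  rw [hprod]
  have hpos : 0 < ∏ i, (1 + |centre p i|) ^ 3 := Finset.prod_pos fun i _ => by positivity
  exact (inv_le_inv₀ (by positivity) hpos).2 (prod_one_add_abs_pow_le (centre p))

/-- **The weights are summable with total `≤ 81/32`.** [folklore] -/
theorem summable_weight :
    Summable (fun p : PieceIdx => spacing p.1 ^ 5 * ((1 + ‖centre p‖) ^ 14)⁻¹) ∧
      ∑' p : PieceIdx, spacing p.1 ^ 5 * ((1 + ‖centre p‖) ^ 14)⁻¹ ≤ 81 / 32 := by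
  have hnn : 0 ≤ fun p : PieceIdx => spacing p.1 ^ 5 * ((1 + ‖centre p‖) ^ 14)⁻¹ := fun p =>
    mul_nonneg (pow_nonneg (spacing_pos p.1).le 5) (by positivity)
  have hbd : ∀ u : Finset PieceIdx, ∑ p ∈ u, spacing p.1 ^ 5 * ((1 + ‖centre p‖) ^ 14)⁻¹ ≤ 81 / 32 := fun u =>
    (Finset.sum_le_sum fun p _ => weight_le_prod p).trans (sum_dyadic_weight_le u)
  exact ⟨summable_of_sum_le hnn hbd, Real.tsum_le_of_sum_le hnn hbd⟩

end Summit.QuantumFields.YangMills.Theorems.RPOnsetFloorPosTimeSynth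

end
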